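import Summits.BirchSwinnertonDyer.BirchSwinnertonDyer.Theorems.EisensteinDepletionAtTwoStarE1MTwoPrints
import HarnessLib

/-!
# Crux (★-GO₂^Σ) `StarGO2Sigma` (stmt-BirchSwinnertonDyer-27046) FROM MODULARITY + TWO PRINTS: (F) and UBD — line `star`, ledger form
# (lead star-p1 GEN 23, 2026-08-29)

Line `star` v19 (Theorems/EisensteinDepletionAtTwoStarE1MTwoPrints + …StarOddManinDoor, lead GEN 21) proves the generic half `StarGO2Sigma` of the
Σ-split of E1M_NSF from modularity, (OddManin₂) and UBD (`KummerDoor.starGO2Sigma_of_modularity_oddManin_ubd`: line kummer's K-Θ door with the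
Abbes–Ullmo input cut to its residue «the `X₀(N)`-Manin multiple `q` is odd»), and DERIVES (OddManin₂) from modularity + (F) + UBD by the parity
split (`EvenBranch.oddManinAtTwo_of_cuspNonsingular_ubd`: even square law, étale second point, double lift).  `StarGO2Sigma` has no modularity
binder of its own (its binders carry the newform `f` of `W` and `W₀`, but the K-Θ door needs the level = conductor print for OTHER curves of the
class), so modularity `exists_isNewformOf` stays a third named hypothesis here.  This file records the composite BY NAME so that the ledger carries
the conditional result on item 27046 itself.

HONEST FRAMING: a CONDITIONAL RESULT — `StarGO2Sigma` is proved MODULO modularity `exists_isNewformOf` [Wiles, Taylor–Wiles, BCDT] and the two named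
published facts `gamma1Parametrization_cuspImage_nonsingularReduction` [(F): Conrad–Edixhoven–Stein 2003 §6.1.2 + Katz–Mazur Thm. 12.6.1 + Silverman
ATAEC IV.9.1] and `CalegariDimitrovTang2025_unboundedDenominators` [UBD]; item 27046 is NOT closed by this file; the leaf T-r3₂ and BSD are NOT proved
(PARTITION D-0054: none — r_an ≥ 2, axis S0; no S0 motion).  No `sorry`, no new definition.
-/

set_option linter.dupNamespace false
set_option autoImplicit false

noncomputable section

namespace Summit.BirchSwinnertonDyer.BirchSwinnertonDyer.Theorems.DepletionAtTwo.StarTwoPrints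

open Literature.NumberTheory.EllipticCurves.ModularForms
open Summit.BirchSwinnertonDyer.BirchSwinnertonDyer.Theorems.DepletionAtTwo

/-- **(★-GO₂^Σ) `StarGO2Sigma` (stmt-BirchSwinnertonDyer-27046) from modularity + the two prints (F) + UBD** —
`KummerDoor.starGO2Sigma_of_modularity_oddManin_ubd` with (OddManin₂) supplied by `EvenBranch.oddManinAtTwo_of_cuspNonsingular_ubd`.
CONDITIONAL RESULT (three named facts: modularity, (F), UBD); 27046 is NOT closed; BSD is not proved.
[cite: Wiles1995] [cite: ConradEdixhovenStein2003, §6.1.2 proof of Lemma 6.1.6 (p. 381)] [cite: CalegariDimitrovTang2025, Thm. 1.0.1]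
[cite: Vatsal2005, Thm. 1.1] -/
theorem starGO2Sigma_of_modularity_twoPrints (hnf : exists_isNewformOf)
    (hF : gamma1Parametrization_cuspImage_nonsingularReduction)
    (hU : Literature.NumberTheory.Automorphic.CalegariDimitrovTang2025_unboundedDenominators) :
    Summit.BirchSwinnertonDyer.BirchSwinnertonDyer.Theses.EisensteinDepletionAtTwo.StarGO2Sigma :=
  KummerDoor.starGO2Sigma_of_modularity_oddManin_ubd hnf (EvenBranch.oddManinAtTwo_of_cuspNonsingular_ubd hnf hF hU) hU

end Summit.BirchSwinnertonDyer.BirchSwinnertonDyer.Theorems.DepletionAtTwo.StarTwoPrints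

end
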